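import Summits.AnomalousDissipation.AnomalousDissipation.Theorems.MarginalStabilityChainStrainedLayerLawStubStrainWorkIdentityA
import HarnessLib

/-!
# Stub `stub_strainWorkIdentity` of line `strain-work-sum-rule` (crux `MarginalStabilityChain.StrainedLayerLaw`,
# stmt-AnomalousDissipation-3007) — tool file C: time regularity of the strip functionals

Support file (`--supports stmt-AnomalousDissipation-3007`; registered sub-goal
`stub_strainWorkIdentity_timeRegularity`), everything proved:

* joint continuity on `(0, ∞) × ℝ²` of `∂ₓu`, `∂_yu`, `∂ₜu` for a space–time field `u` that is `C²` jointly on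
  `(0, ∞) × ℝ²` (the joint Fréchet derivative applied to a coordinate vector), and continuity of the time lines
  of `u`, `∂ₓu`, `∂_yu`, `∂ₜu`;
* for velocity fields with uniform shear tails on `[a, b] ⊂ (0, ∞)`: differentiability in time of the strip
  excess energy `E(σ) = ∫∫ (u² + v² − ¼)/2` with `E′ = ∫∫ (u∂ₜu + v∂ₜv)` (differentiation under the integral
  sign, as in `IsStretchedLayerNSSolutionOn.hasDerivAt_shiftEnergy`), and continuity on `[a, b]` of `E`, of the
  strip strain work `∫∫ (¼ − u² + v²)/2` and of the strip enstrophy `∫∫ |∇(u,v)|²` (dominated convergence).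

References: A. J. Majda, A. L. Bertozzi, *Vorticity and Incompressible Flow*, CUP 2002, §3.1.1 (p. 87–88).
-/

-- `Summit.<Summit>.<Problem>` is the tree's mandated summit-side namespace (CONVENTIONS §2); for this
-- single-conjunct summit the two coincide, so the duplicate is deliberate.
set_option linter.dupNamespace false

noncomputable section

open scoped Topology ENNReal
open Filter Set Function MeasureTheory

namespace Summit.AnomalousDissipation.AnomalousDissipation.Theorems.StrainedLayerLaw.StrainWorkSumRule

open Literature.Analysis.FluidPDE Literature.Analysis.FluidPDE.StretchedLayer

/-! ## Joint continuity of the first derivatives of a space–time field -/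

section SpaceTime

variable {u : ℝ → ℝ → ℝ → ℝ}

/-- For a field jointly `C²` on `(0,∞) × ℝ²`, `(t,x,y) ↦ ∂ₓu(t,x,y)` is continuous on `(0,∞) × ℝ²` (it is the
joint Fréchet derivative applied to `(0,1,0)`). [folklore] -/
theorem continuousOn_dX_spacetime
    (hu : ContDiffOn ℝ 2 (fun q : ℝ × ℝ × ℝ => u q.1 q.2.1 q.2.2) (Ioi 0 ×ˢ univ)) :
    ContinuousOn (fun q : ℝ × ℝ × ℝ => dX (u q.1) q.2.1 q.2.2) (Ioi 0 ×ˢ univ) := by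
  have hO : IsOpen (Ioi (0:ℝ) ×ˢ (univ : Set (ℝ × ℝ))) := isOpen_Ioi.prod isOpen_univ
  have hcont : ContinuousOn (fun r => fderiv ℝ (fun q : ℝ × ℝ × ℝ => u q.1 q.2.1 q.2.2) r)
      (Ioi 0 ×ˢ univ) := hu.continuousOn_fderiv_of_isOpen hO (by norm_num)
  refine (hcont.clm_apply continuousOn_const (g := fun _ => ((0:ℝ), (1:ℝ), (0:ℝ)))).congr ?_
  rintro ⟨t, x, y⟩ hq
  have hd : DifferentiableAt ℝ (fun q : ℝ × ℝ × ℝ => u q.1 q.2.1 q.2.2) (t, x, y) :=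
    (hu.differentiableOn two_ne_zero _ hq).differentiableAt (hO.mem_nhds hq)
  have h1 : HasDerivAt (fun s : ℝ => ((t, s, y) : ℝ × ℝ × ℝ)) ((0:ℝ), (1:ℝ), (0:ℝ)) x :=
    (hasDerivAt_const x t).prodMk ((hasDerivAt_id x).prodMk (hasDerivAt_const x y))
  exact (hd.hasFDerivAt.comp_hasDerivAt x h1).deriv

/-- For a field jointly `C²` on `(0,∞) × ℝ²`, `(t,x,y) ↦ ∂_yu(t,x,y)` is continuous on `(0,∞) × ℝ²`.
[folklore] -/
theorem continuousOn_dY_spacetime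
    (hu : ContDiffOn ℝ 2 (fun q : ℝ × ℝ × ℝ => u q.1 q.2.1 q.2.2) (Ioi 0 ×ˢ univ)) :
    ContinuousOn (fun q : ℝ × ℝ × ℝ => dY (u q.1) q.2.1 q.2.2) (Ioi 0 ×ˢ univ) := by
  have hO : IsOpen (Ioi (0:ℝ) ×ˢ (univ : Set (ℝ × ℝ))) := isOpen_Ioi.prod isOpen_univ
  have hcont : ContinuousOn (fun r => fderiv ℝ (fun q : ℝ × ℝ × ℝ => u q.1 q.2.1 q.2.2) r)
      (Ioi 0 ×ˢ univ) := hu.continuousOn_fderiv_of_isOpen hO (by norm_num)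
  refine (hcont.clm_apply continuousOn_const (g := fun _ => ((0:ℝ), (0:ℝ), (1:ℝ)))).congr ?_
  rintro ⟨t, x, y⟩ hq
  have hd : DifferentiableAt ℝ (fun q : ℝ × ℝ × ℝ => u q.1 q.2.1 q.2.2) (t, x, y) :=
    (hu.differentiableOn two_ne_zero _ hq).differentiableAt (hO.mem_nhds hq)
  have h1 : HasDerivAt (fun s : ℝ => ((t, x, s) : ℝ × ℝ × ℝ)) ((0:ℝ), (0:ℝ), (1:ℝ)) y :=
    (hasDerivAt_const y t).prodMk ((hasDerivAt_const y x).prodMk (hasDerivAt_id y))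
  exact (hd.hasFDerivAt.comp_hasDerivAt y h1).deriv

/-- For a field jointly `C²` on `(0,∞) × ℝ²`, `(t,x,y) ↦ ∂ₜu(t,x,y)` is continuous on `(0,∞) × ℝ²`.
[folklore] -/
theorem continuousOn_deriv_time_spacetime
    (hu : ContDiffOn ℝ 2 (fun q : ℝ × ℝ × ℝ => u q.1 q.2.1 q.2.2) (Ioi 0 ×ˢ univ)) :
    ContinuousOn (fun q : ℝ × ℝ × ℝ => deriv (fun s => u s q.2.1 q.2.2) q.1) (Ioi 0 ×ˢ univ) := by
  have hO : IsOpen (Ioi (0:ℝ) ×ˢ (univ : Set (ℝ × ℝ))) := isOpen_Ioi.prod isOpen_univ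
  have hcont : ContinuousOn (fun r => fderiv ℝ (fun q : ℝ × ℝ × ℝ => u q.1 q.2.1 q.2.2) r)
      (Ioi 0 ×ˢ univ) := hu.continuousOn_fderiv_of_isOpen hO (by norm_num)
  refine (hcont.clm_apply continuousOn_const (g := fun _ => ((1:ℝ), (0:ℝ), (0:ℝ)))).congr ?_
  rintro ⟨t, x, y⟩ hq
  have hd : DifferentiableAt ℝ (fun q : ℝ × ℝ × ℝ => u q.1 q.2.1 q.2.2) (t, x, y) :=
    (hu.differentiableOn two_ne_zero _ hq).differentiableAt (hO.mem_nhds hq)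
  have h1 : HasDerivAt (fun s : ℝ => ((s, x, y) : ℝ × ℝ × ℝ)) ((1:ℝ), (0:ℝ), (0:ℝ)) t :=
    (hasDerivAt_id t).prodMk ((hasDerivAt_const t x).prodMk (hasDerivAt_const t y))
  exact (hd.hasFDerivAt.comp_hasDerivAt t h1).deriv

/-- Time lines `s ↦ u(s,x,y)` of a field jointly `C²` on `(0,∞) × ℝ²` are continuous on `(0,∞)`. [folklore] -/
theorem continuousOn_time_line
    (hu : ContDiffOn ℝ 2 (fun q : ℝ × ℝ × ℝ => u q.1 q.2.1 q.2.2) (Ioi 0 ×ˢ univ)) (x y : ℝ) :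
    ContinuousOn (fun s => u s x y) (Ioi 0) :=
  hu.continuousOn.comp (f := fun s : ℝ => ((s, x, y) : ℝ × ℝ × ℝ))
    (continuous_id.prodMk continuous_const).continuousOn fun _ hs => ⟨hs, mem_univ _⟩

/-- Time lines of `∂ₓu` are continuous on `(0,∞)`. [folklore] -/
theorem continuousOn_time_dX
    (hu : ContDiffOn ℝ 2 (fun q : ℝ × ℝ × ℝ => u q.1 q.2.1 q.2.2) (Ioi 0 ×ˢ univ)) (x y : ℝ) :
    ContinuousOn (fun s => dX (u s) x y) (Ioi 0) :=
  (continuousOn_dX_spacetime hu).comp (f := fun s : ℝ => ((s, x, y) : ℝ × ℝ × ℝ))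
    (continuous_id.prodMk continuous_const).continuousOn fun _ hs => ⟨hs, mem_univ _⟩

/-- Time lines of `∂_yu` are continuous on `(0,∞)`. [folklore] -/
theorem continuousOn_time_dY
    (hu : ContDiffOn ℝ 2 (fun q : ℝ × ℝ × ℝ => u q.1 q.2.1 q.2.2) (Ioi 0 ×ˢ univ)) (x y : ℝ) :
    ContinuousOn (fun s => dY (u s) x y) (Ioi 0) :=
  (continuousOn_dY_spacetime hu).comp (f := fun s : ℝ => ((s, x, y) : ℝ × ℝ × ℝ))
    (continuous_id.prodMk continuous_const).continuousOn fun _ hs => ⟨hs, mem_univ _⟩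

/-- Time lines of `∂ₜu` are continuous on `(0,∞)`. [folklore] -/
theorem continuousOn_time_deriv
    (hu : ContDiffOn ℝ 2 (fun q : ℝ × ℝ × ℝ => u q.1 q.2.1 q.2.2) (Ioi 0 ×ˢ univ)) (x y : ℝ) :
    ContinuousOn (fun s => deriv (fun r => u r x y) s) (Ioi 0) :=
  (continuousOn_deriv_time_spacetime hu).comp (f := fun s : ℝ => ((s, x, y) : ℝ × ℝ × ℝ))
    (continuous_id.prodMk continuous_const).continuousOn fun _ hs => ⟨hs, mem_univ _⟩

end SpaceTime

/-! ## Time regularity of the strip functionals -/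

section TimeRegularity

/-- **Time regularity of the strip functionals** (registered sub-goal `stub_strainWorkIdentity_timeRegularity`).
For velocity fields `u, v` jointly `C²` on `(0, ∞) × ℝ²` with shear tails `SliceTails C k (u s) (v s)` and time
derivatives decaying like `Ce^{−k|y|}` for every `s ∈ [a, b] ⊂ (0, ∞)` (`k > 0`): the strip excess energy
`E(σ) = ∫∫ (u² + v² − ¼)/2` is differentiable at every `s ∈ (a, b)` with derivative `∫∫ (u∂ₜu + v∂ₜv)`
(differentiation under the integral sign, `hasDerivAt_integral_of_dominated_loc_of_deriv_le`, domination
`((1 + C)C + C²)e^{−k|y|}`), and `E`, the strip strain work `∫∫ (¼ − u² + v²)/2` and the strip enstrophy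
`∫∫ |∇(u, v)|²` are continuous on `[a, b]` (dominated convergence, `continuousOn_of_dominated`). [folklore] -/
theorem stub_strainWorkIdentity_timeRegularity : ∀ (L a b C k : ℝ) (u v : ℝ → ℝ → ℝ → ℝ), 0 < a → a < b →
    0 < k → ContDiffOn ℝ 2 (fun q : ℝ × ℝ × ℝ => u q.1 q.2.1 q.2.2) (Ioi 0 ×ˢ univ) →
    ContDiffOn ℝ 2 (fun q : ℝ × ℝ × ℝ => v q.1 q.2.1 q.2.2) (Ioi 0 ×ˢ univ) →
    (∀ s ∈ Icc a b, SliceTails C k (u s) (v s)) →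
    (∀ s ∈ Icc a b, ∀ x y, |deriv (fun r => u r x y) s| + |deriv (fun r => v r x y) s| ≤
      C * Real.exp (-k * |y|)) →
      (∀ s ∈ Ioo a b, HasDerivAt
          (fun σ => ∫ q in Ioc 0 L ×ˢ univ, (u σ q.1 q.2 ^ 2 + v σ q.1 q.2 ^ 2 - 1 / 4) / 2)
          (∫ q in Ioc 0 L ×ˢ univ, (u s q.1 q.2 * deriv (fun r => u r q.1 q.2) s +
            v s q.1 q.2 * deriv (fun r => v r q.1 q.2) s)) s) ∧
      ContinuousOn (fun σ => ∫ q in Ioc 0 L ×ˢ univ, (u σ q.1 q.2 ^ 2 + v σ q.1 q.2 ^ 2 - 1 / 4) / 2)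
        (Icc a b) ∧
      ContinuousOn (fun σ => ∫ q in Ioc 0 L ×ˢ univ, (1 / 4 - u σ q.1 q.2 ^ 2 + v σ q.1 q.2 ^ 2) / 2)
        (Icc a b) ∧
      ContinuousOn (fun σ => ∫ q in Ioc 0 L ×ˢ univ, (dX (u σ) q.1 q.2 ^ 2 + dY (u σ) q.1 q.2 ^ 2 +
          dX (v σ) q.1 q.2 ^ 2 + dY (v σ) q.1 q.2 ^ 2)) (Icc a b) := by
  intro L a b C k u v ha hab hk hu hv hST hT
  have hpos : ∀ {s : ℝ}, s ∈ Icc a b → 0 < s := fun hs => ha.trans_le hs.1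
  have hIcc : Icc a b ⊆ Ioi 0 := fun s hs => hpos hs
  have hC : 0 ≤ C := (hST a (left_mem_Icc.2 hab.le)).nonneg
  -- the weight on the strip
  have hec : Continuous (fun q : ℝ × ℝ => Real.exp (-k * |q.2|)) :=
    Real.continuous_exp.comp (continuous_const.mul (continuous_abs.comp continuous_snd))
  have hwI : ∀ M : ℝ, 0 ≤ M →
      IntegrableOn (fun q : ℝ × ℝ => M * Real.exp (-k * |q.2|)) (Ioc 0 L ×ˢ univ) :=
    fun M hM => integrableOn_strip_of_abs_le_exp (continuous_const.mul hec) hM hk fun x _ y => by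
      rw [abs_of_nonneg (by positivity)]
  -- slice regularity for `s > 0`
  have cu : ∀ {s : ℝ}, 0 < s → ContDiff ℝ 2 (fun q : ℝ × ℝ => u s q.1 q.2) := fun hs =>
    contDiff_slice hu (mem_Ioi.2 hs)
  have cv : ∀ {s : ℝ}, 0 < s → ContDiff ℝ 2 (fun q : ℝ × ℝ => v s q.1 q.2) := fun hs =>
    contDiff_slice hv (mem_Ioi.2 hs)
  have cut : ∀ {s : ℝ}, 0 < s → Continuous (fun q : ℝ × ℝ => deriv (fun r => u r q.1 q.2) s) :=
    fun hs => continuous_deriv_time isOpen_Ioi hu (mem_Ioi.2 hs)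
  have cvt : ∀ {s : ℝ}, 0 < s → Continuous (fun q : ℝ × ℝ => deriv (fun r => v r q.1 q.2) s) :=
    fun hs => continuous_deriv_time isOpen_Ioi hv (mem_Ioi.2 hs)
  -- time-line continuity on `[a, b]`
  have tu : ∀ x y, ContinuousOn (fun s => u s x y) (Icc a b) := fun x y =>
    (continuousOn_time_line hu x y).mono hIcc
  have tv : ∀ x y, ContinuousOn (fun s => v s x y) (Icc a b) := fun x y =>
    (continuousOn_time_line hv x y).mono hIcc
  -- atomic bounds on `[a, b]`
  have bu : ∀ s ∈ Icc a b, ∀ x y, |u s x y| ≤ 1 + C := fun s hs => (hST s hs).abs_u_le hk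
  have bv : ∀ s ∈ Icc a b, ∀ x y, |v s x y| ≤ C := fun s hs => (hST s hs).abs_v_le_const hk
  have but : ∀ s ∈ Icc a b, ∀ x y, |deriv (fun r => u r x y) s| ≤ C * Real.exp (-k * |y|) :=
    fun s hs x y => by linarith [hT s hs x y, abs_nonneg (deriv (fun r => v r x y) s)]
  have bvt : ∀ s ∈ Icc a b, ∀ x y, |deriv (fun r => v r x y) s| ≤ C * Real.exp (-k * |y|) :=
    fun s hs x y => by linarith [hT s hs x y, abs_nonneg (deriv (fun r => u r x y) s)]
  refine ⟨?_, ?_, ?_, ?_⟩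
  · -- differentiation of the strip energy under the integral sign
    intro s hs
    have hsab : s ∈ Icc a b := Ioo_subset_Icc_self hs
    have hs0 : 0 < s := hpos hsab
    have hN : Ioo a b ∈ 𝓝 s := Ioo_mem_nhds hs.1 hs.2
    have hFmeas : ∀ᶠ σ in 𝓝 s, AEStronglyMeasurable
        (fun q : ℝ × ℝ => (u σ q.1 q.2 ^ 2 + v σ q.1 q.2 ^ 2 - 1 / 4) / 2)
        (volume.restrict (Ioc 0 L ×ˢ univ)) := by
      filter_upwards [hN] with σ hσ
      have hσ0 := hpos (Ioo_subset_Icc_self hσ)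
      exact (contDiff_energyDensity (cu hσ0) (cv hσ0)).continuous.aestronglyMeasurable
    have hFint : IntegrableOn (fun q : ℝ × ℝ => (u s q.1 q.2 ^ 2 + v s q.1 q.2 ^ 2 - 1 / 4) / 2)
        (Ioc 0 L ×ˢ univ) :=
      integrableOn_strip_of_abs_le_exp (contDiff_energyDensity (cu hs0) (cv hs0)).continuous
        (by positivity : 0 ≤ C / 2) hk fun x _ y => (hST s hsab).abs_energyDensity_le x y
    have hF'meas : AEStronglyMeasurable (fun q : ℝ × ℝ =>
        u s q.1 q.2 * deriv (fun r => u r q.1 q.2) s + v s q.1 q.2 * deriv (fun r => v r q.1 q.2) s)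
        (volume.restrict (Ioc 0 L ×ˢ univ)) :=
      (((cu hs0).continuous.mul (cut hs0)).add ((cv hs0).continuous.mul (cvt hs0))).aestronglyMeasurable
    have hF'le : ∀ q : ℝ × ℝ, ∀ σ ∈ Ioo a b,
        ‖u σ q.1 q.2 * deriv (fun r => u r q.1 q.2) σ + v σ q.1 q.2 * deriv (fun r => v r q.1 q.2) σ‖ ≤
          ((1 + C) * C + C * C) * Real.exp (-k * |q.2|) := by
      intro q σ hσ
      have hσ' := Ioo_subset_Icc_self hσ
      rw [Real.norm_eq_abs]
      have i1 : |u σ q.1 q.2 * deriv (fun r => u r q.1 q.2) σ| ≤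
          (1 + C) * (C * Real.exp (-k * |q.2|)) := by
        rw [abs_mul]
        exact mul_le_mul (bu σ hσ' q.1 q.2) (but σ hσ' q.1 q.2) (abs_nonneg _) (by linarith)
      have i2 : |v σ q.1 q.2 * deriv (fun r => v r q.1 q.2) σ| ≤ C * (C * Real.exp (-k * |q.2|)) := by
        rw [abs_mul]
        exact mul_le_mul (bv σ hσ' q.1 q.2) (bvt σ hσ' q.1 q.2) (abs_nonneg _) hC
      calc _ ≤ |u σ q.1 q.2 * deriv (fun r => u r q.1 q.2) σ| +
            |v σ q.1 q.2 * deriv (fun r => v r q.1 q.2) σ| := abs_add_le _ _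
        _ ≤ (1 + C) * (C * Real.exp (-k * |q.2|)) + C * (C * Real.exp (-k * |q.2|)) := add_le_add i1 i2
        _ = ((1 + C) * C + C * C) * Real.exp (-k * |q.2|) := by ring
    have hdiff : ∀ q : ℝ × ℝ, ∀ σ ∈ Ioo a b,
        HasDerivAt (fun σ => (u σ q.1 q.2 ^ 2 + v σ q.1 q.2 ^ 2 - 1 / 4) / 2)
          (u σ q.1 q.2 * deriv (fun r => u r q.1 q.2) σ + v σ q.1 q.2 * deriv (fun r => v r q.1 q.2) σ)
          σ := by
      intro q σ hσ
      have hσ0 := hpos (Ioo_subset_Icc_self hσ)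
      have h1 := hasDerivAt_time_of_contDiffOn_Ioi hu hσ0 q.1 q.2
      have h2 := hasDerivAt_time_of_contDiffOn_Ioi hv hσ0 q.1 q.2
      refine ((((h1.pow 2).add (h2.pow 2)).sub (hasDerivAt_const σ (1 / 4 : ℝ))).div_const 2).congr_deriv
        ?_
      norm_num
      ring
    have key := hasDerivAt_integral_of_dominated_loc_of_deriv_le
      (μ := volume.restrict (Ioc 0 L ×ˢ univ)) (x₀ := s)
      (bound := fun q : ℝ × ℝ => ((1 + C) * C + C * C) * Real.exp (-k * |q.2|)) hN hFmeas hFint hF'meas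
      (Eventually.of_forall fun q σ hσ => hF'le q σ hσ) (hwI _ (by positivity))
      (Eventually.of_forall hdiff)
    exact key.2
  · -- continuity of the strip energy
    refine continuousOn_of_dominated (bound := fun q : ℝ × ℝ => C / 2 * Real.exp (-k * |q.2|))
      (fun σ hσ => (contDiff_energyDensity (cu (hpos hσ)) (cv (hpos hσ))).continuous.aestronglyMeasurable)
      (fun σ hσ => Eventually.of_forall fun q => ?_) (hwI _ (by positivity))
      (Eventually.of_forall fun q => ?_)
    · rw [Real.norm_eq_abs]
      exact (hST σ hσ).abs_energyDensity_le q.1 q.2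
    · exact ((((tu q.1 q.2).pow 2).add ((tv q.1 q.2).pow 2)).sub continuousOn_const).div_const 2
  · -- continuity of the strip strain work
    refine continuousOn_of_dominated (bound := fun q : ℝ × ℝ => (C / 2 + C ^ 2) * Real.exp (-k * |q.2|))
      (fun σ hσ => ?_) (fun σ hσ => Eventually.of_forall fun q => ?_) (hwI _ (by positivity))
      (Eventually.of_forall fun q => ?_)
    · exact (((continuous_const.sub ((cu (hpos hσ)).continuous.pow 2)).add
        ((cv (hpos hσ)).continuous.pow 2)).div_const 2).aestronglyMeasurable
    · rw [Real.norm_eq_abs]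
      exact (hST σ hσ).abs_workDensity_le hk q.1 q.2
    · exact (((continuousOn_const.sub ((tu q.1 q.2).pow 2)).add ((tv q.1 q.2).pow 2))).div_const 2
  · -- continuity of the strip enstrophy
    refine continuousOn_of_dominated (bound := fun q : ℝ × ℝ => C ^ 2 * Real.exp (-k * |q.2|))
      (fun σ hσ => ?_) (fun σ hσ => Eventually.of_forall fun q => ?_) (hwI _ (by positivity))
      (Eventually.of_forall fun q => ?_)
    · have h1 : ContDiff ℝ 1 (fun q : ℝ × ℝ => u σ q.1 q.2) := (cu (hpos hσ)).of_le one_le_two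
      have h2 : ContDiff ℝ 1 (fun q : ℝ × ℝ => v σ q.1 q.2) := (cv (hpos hσ)).of_le one_le_two
      exact (((((continuous_dX h1).pow 2).add ((continuous_dY h1).pow 2)).add
        ((continuous_dX h2).pow 2)).add ((continuous_dY h2).pow 2)).aestronglyMeasurable
    · rw [Real.norm_eq_abs]
      exact (hST σ hσ).abs_gradSq_le hk q.1 q.2
    · exact (((((continuousOn_time_dX hu q.1 q.2).mono hIcc).pow 2).add
        (((continuousOn_time_dY hu q.1 q.2).mono hIcc).pow 2)).add
        (((continuousOn_time_dX hv q.1 q.2).mono hIcc).pow 2)).add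
        (((continuousOn_time_dY hv q.1 q.2).mono hIcc).pow 2)

end TimeRegularity

end Summit.AnomalousDissipation.AnomalousDissipation.Theorems.StrainedLayerLaw.StrainWorkSumRule

end
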